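import Summits.BirchSwinnertonDyer.Rank1Residual.ManinAdditive.Lambda128BrandtDegreeLawCert
import Summits.BirchSwinnertonDyer.BirchSwinnertonDyer.Theorems.Rank2ObservatoryConductorCertStep2
import Literature.NumberTheory.EllipticCurves.RationalIsogenyFrobeniusCriterion
import Literature.NumberTheory.DiophantineGeometry.ConductorAdditiveProofs
import Literature.NumberTheory.DiophantineGeometry.ConductorFactorizationProofs
import HarnessLib

/-!
# E-desc-153 `Psi128Brandt.Lambda128BrandtWLawAtPrime` is FALSE AS TYPED modulo E-desc-145 — the junk local root number at `2`
# (cell bsd-f2-manin, REF1 statement audit §R191 of ty p737608 / desc MEMO-desc §37; supports C2 `ManinOddAtFour`, stmt-BirchSwinnertonDyer-22967)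

CLASS: refuted-misstated (modulo the module's own construction row E-desc-145 `Lambda128BrandtNewLineAtPrime`;
unconditionally: the two rows are JOINTLY INCONSISTENT as typed).  Row E-desc-153 reads the local root number
`W₂(E)` through `WeierstrassCurve.localRootNumberAt v` (`v` the place over `2`), i.e. through Rohrlich's
`WeierstrassCurve.localRootNumber`, whose branch for ADDITIVE reduction in residue characteristic `2` is the
documented junk value `0` (`WeierstrassCurve.localRootNumber_of_hasAdditiveReduction_of_ringChar`).  Every curve
with `conductorNorm = 128·p` (`p` an odd prime) has conductor exponent `7 ≥ 2` at `2`
(`factorization_conductorNorm`), hence additive reduction there (`two_le_conductorExponent_iff`), hence the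
law's right-hand side is `((-(0) * σ_z^o : ℤ) : ℤ[i]) * f s x = 0`: the typed law says `rw o p f ≡ 0`, i.e.
`f` vanishes on the image of the translation `x ↦ act p (i+j) x`.  At `p = 3` that translation is onto
(`decide`), so `f = 0`, contradicting `IsPrimitiveGauss`.  So the typed W-law says "NO primitive λ-Hecke
eigenfunction exists for any curve of conductor `384`", while row E-desc-145 says one exists for every curve of
conductor `128·p` — WITNESS: `p = 3`, the curve 384b1 = `[0, −1, 0, 2, −2]` (conductor `384` by the tree's
kernel certificates `RNCert` + `Step2Cert`, globally minimal since `|Δ| = 1152 < 2¹²`).  (The module's own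
certificate `certificates_stabiliser : rw 0 3 g384a s x = −g384a s x ≠ 0` shows the intended value `−W₂ = −1`
at 384a; the typed right-hand side evaluates to `0` there.)

REPAIRED STATEMENT `C′` (believed to be what desc intends — "`W₂(E)` is the local root number at `2`"; the
witness misses it, nothing here bears on its truth): replace the junk-valued `-(W.localRootNumberAt v)` by the
tree's CORRECTED Kellock–Dokchitser value `-(W.rootNumberTwo')`
(`Literature/NumberTheory/EllipticCurves/RootNumberTableTwo.lean`; equivalently `-(W.tableLocalRootNumberAt' v)`)
and drop the `v` binder:
`∀ (p : ℕ), p.Prime → p ≠ 2 → ∀ (W : WeierstrassCurve ℚ) [W.IsElliptic] [W.IsGloballyMinimal],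
  W.conductorNorm ℤ = 128 * p → ∀ (o : Fin 2) (f : Fin 2 → Fin (p + 1) → GaussianInt), IsPrimitiveGauss p f →
  IsLamHeckeEigen o p f (fun n => W.LFunction n) → ∀ (s : Fin 2) (x : Fin (p + 1)),
  rw o p f s x = ((-(W.rootNumberTwo') * z0SignAt128 W ^ (o : ℕ) : ℤ) : GaussianInt) * f s x`.
No other row of `Lambda128BrandtDegreeLaw.lean` mentions `localRootNumberAt`.  BSD is not proved by this;
Manin's conjecture is not proved by this; C2 OPEN.
-/

set_option autoImplicit false
set_option linter.dupNamespace false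

open IsDedekindDomain Rat.HeightOneSpectrum WeierstrassCurve GaussianInt
open Summit.BirchSwinnertonDyer.Rank1Residual.ManinAdditive.HurwitzBrandt
open Summit.BirchSwinnertonDyer.Rank1Residual.ManinAdditive.Psi128Brandt
open Summit.BirchSwinnertonDyer.BirchSwinnertonDyer.Rank2Observatory
open Summit.BirchSwinnertonDyer.BirchSwinnertonDyer.Rank2Observatory.RootNumber
open Summit.BirchSwinnertonDyer.BirchSwinnertonDyer.Rank2Observatory.Tate

namespace Summit.BirchSwinnertonDyer.BirchSwinnertonDyer.Theorems.ManinOddAtFour.Negative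

/-! ### §1. The junk value: `localRootNumberAt v = 0` at the place over `2` when `N = 128·p` -/

/-- `N(W) = 128·p` with `p` an odd prime forces conductor exponent `7` at the place over `2`. [folklore] -/
theorem conductorExponent_two_eq_seven_of_conductorNorm {p : ℕ} (hp : p.Prime) (hp2 : p ≠ 2)
    (W : WeierstrassCurve ℚ) [W.IsElliptic] (hN : W.conductorNorm ℤ = 128 * p)
    (v : HeightOneSpectrum ℤ) (hv : natGenerator v = 2) : W.conductorExponent v = 7 := by
  have h := W.factorization_conductorNorm_holds v
  rw [hv, hN] at h
  rw [← h, Nat.factorization_mul (by norm_num) hp.ne_zero, Finsupp.add_apply,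
    show (128 : ℕ) = 2 ^ 7 by norm_num, Nat.factorization_pow, Finsupp.smul_apply, smul_eq_mul,
    Nat.prime_two.factorization, hp.factorization, Finsupp.single_apply, Finsupp.single_apply,
    if_pos rfl, if_neg hp2]
  rfl

/-- hence ADDITIVE reduction at the place over `2`. [folklore] -/
theorem hasAdditiveReductionAt_two_of_conductorNorm {p : ℕ} (hp : p.Prime) (hp2 : p ≠ 2)
    (W : WeierstrassCurve ℚ) [W.IsElliptic] (hN : W.conductorNorm ℤ = 128 * p)
    (v : HeightOneSpectrum ℤ) (hv : natGenerator v = 2) : W.HasAdditiveReductionAt v :=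
  (W.two_le_conductorExponent_iff_holds v).mp
    (by rw [conductorExponent_two_eq_seven_of_conductorNorm hp hp2 W hN v hv]; norm_num)

/-- THE JUNK VALUE.  `WeierstrassCurve.localRootNumberAt v` is `0` (documented junk branch of
`WeierstrassCurve.localRootNumber` for additive reduction in residue characteristic `2`) at the place over
`2` of every curve of conductor `128·p`. [folklore] -/
theorem localRootNumberAt_two_eq_zero_of_conductorNorm {p : ℕ} (hp : p.Prime) (hp2 : p ≠ 2)
    (W : WeierstrassCurve ℚ) [W.IsElliptic] (hN : W.conductorNorm ℤ = 128 * p)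
    (v : HeightOneSpectrum ℤ) (hv : natGenerator v = 2) : W.localRootNumberAt v = 0 := by
  have hadd := hasAdditiveReductionAt_two_of_conductorNorm hp hp2 W hN v hv
  have hchar : ringChar (IsLocalRing.ResidueField (v.adicCompletionIntegers ℚ)) = 2 := by
    rw [ringChar_residueField, hv]
  exact localRootNumber_of_hasAdditiveReduction_of_ringChar _ _ hadd (Or.inl hchar)

/-! ### §2. The typed W-law forces `f ∘ act p (i+j) = 0` -/

/-- Under `Lambda128BrandtWLawAtPrime` AS TYPED, every primitive λ-Hecke eigenfunction attached to a curve
of conductor `128·p` vanishes on the image of the translation by `i+j`. [folklore] -/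
theorem lambda128BrandtWLawAtPrime_forces_zero (h : Lambda128BrandtWLawAtPrime) {p : ℕ} (hp : p.Prime)
    (hp2 : p ≠ 2) (W : WeierstrassCurve ℚ) [W.IsElliptic] [W.IsGloballyMinimal]
    (hN : W.conductorNorm ℤ = 128 * p) (o : Fin 2) (f : Fin 2 → Fin (p + 1) → GaussianInt)
    (hprim : IsPrimitiveGauss p f) (heig : IsLamHeckeEigen o p f fun n => W.LFunction n)
    (s : Fin 2) (x : Fin (p + 1)) : f s (act p (0, 2, 2, 0) x) = 0 := by
  have hv : natGenerator (natPlace 2) = 2 := natGenerator_natPlace Nat.prime_two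
  have key := h p hp hp2 W hN (natPlace 2) hv o f hprim heig s x
  rw [localRootNumberAt_two_eq_zero_of_conductorNorm hp hp2 W hN _ hv] at key
  simp only [neg_zero, zero_mul, Int.cast_zero] at key
  unfold rw at key
  have hu : (if o = 0 then (1 : GaussianInt) else -1) ≠ 0 := by split_ifs <;> decide
  exact (mul_eq_zero.mp key).resolve_left hu

/-! ### §3. At `p = 3` the translation by `i+j` is onto, so the law empties the λ-line -/

/-- `x ↦ x·(i+j)` on `P¹(𝔽₃)` is onto (it is the involution `z₀`-translation of orbit I). [folklore] -/
theorem act_three_ij_surjective : ∀ y : Fin (3 + 1), ∃ x : Fin (3 + 1), act 3 (0, 2, 2, 0) x = y := by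
  decide

/-- At conductor `384 = 128·3` the typed W-law leaves NO primitive λ-Hecke eigenfunction in either orbit.
[folklore] -/
theorem lambda128BrandtWLawAtPrime_empties_384 (h : Lambda128BrandtWLawAtPrime) (W : WeierstrassCurve ℚ)
    [W.IsElliptic] [W.IsGloballyMinimal] (hN : W.conductorNorm ℤ = 384) (o : Fin 2)
    (f : Fin 2 → Fin (3 + 1) → GaussianInt) (hprim : IsPrimitiveGauss 3 f) :
    ¬ IsLamHeckeEigen o 3 f fun n => W.LFunction n := by
  intro heig
  have hz : ∀ s x, f s x = 0 := by
    intro s y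
    obtain ⟨x, hx⟩ := act_three_ij_surjective y
    rw [← hx]
    exact lambda128BrandtWLawAtPrime_forces_zero h Nat.prime_three (by norm_num) W (by rw [hN])
      o f hprim heig s x
  have h0 : IsUnit (0 : GaussianInt) := hprim 0 fun s x => by rw [hz s x]
  exact not_isUnit_zero h0

/-! ### §4. The curve 384b1 = `[0, −1, 0, 2, −2]`: conductor `384`, globally minimal (kernel certificates) -/

-- Cremona 384b1 is written literally as `(⟨0, -1, 0, 2, -2⟩ : WeierstrassCurve ℤ)` (no definition, no notation).

/-- Root-number certificate (`2⁷ ∥ Δ`, `2⁴ ∥ c₄`, `2⁶ ∥ c₆`, `3² ∥ Δ` non-split), Tate step-2 certificate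
at `2` (type II, `n = 7`, `f₂ = 7`) and the conductor value `2⁷·3 = 384`, all by `decide`. [folklore] -/
theorem check_384b1 :
    RNCert.check (⟨0, -1, 0, 2, -2⟩ : WeierstrassCurve ℤ) ⟨7, 4, 6, [⟨3, 1, 2, 0, 0⟩]⟩ = true ∧
      Step2Cert.check ⟨2, 0, 0, 0, 7, 2, 0⟩ (⟨0, -1, 0, 2, -2⟩ : WeierstrassCurve ℤ) = true ∧
      RNCert.conductorStep2 ⟨7, 4, 6, [⟨3, 1, 2, 0, 0⟩]⟩ (Step2Cert.f ⟨2, 0, 0, 0, 7, 2, 0⟩) = 384 := by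
  decide +kernel

/-- `384b1` is an elliptic curve (`Δ ≠ 0`, from the certificate). [folklore] -/
theorem isElliptic_384b1 : ((⟨0, -1, 0, 2, -2⟩ : WeierstrassCurve ℤ).baseChange ℚ).IsElliptic := isElliptic_of_check check_384b1.1

/-- `N(384b1) = 384`. [folklore] -/
theorem conductorNorm_384b1 : ((⟨0, -1, 0, 2, -2⟩ : WeierstrassCurve ℤ).baseChange ℚ).conductorNorm ℤ = 384 :=
  (conductorNorm_eq_conductorStep2 check_384b1.1 rfl check_384b1.2.1).trans
    (by exact_mod_cast check_384b1.2.2)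

/-- `Δ(384b1) = −1152 = −2⁷·3²`. [folklore] -/
theorem M384b1_Δ : (⟨0, -1, 0, 2, -2⟩ : WeierstrassCurve ℤ).Δ = -1152 := by decide

/-- `[0, −1, 0, 2, −2]` is a global minimal model (`|Δ| = 1152 < 2¹²`). [folklore] -/
theorem isGloballyMinimal_384b1 : ((⟨0, -1, 0, 2, -2⟩ : WeierstrassCurve ℤ).baseChange ℚ).IsGloballyMinimal :=
  Literature.NumberTheory.EllipticCurves.isGloballyMinimal_baseChange_int (⟨0, -1, 0, 2, -2⟩ : WeierstrassCurve ℤ)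
    (Literature.NumberTheory.EllipticCurves.forall_not_pow_dvd_or_of_bound (⟨0, -1, 0, 2, -2⟩ : WeierstrassCurve ℤ) (B := 2)
      (by rw [M384b1_Δ]; decide) (by rw [M384b1_Δ]; decide)
      (by
        intro q hq hqp
        exfalso
        have : q < 2 := Finset.mem_range.mp hq
        interval_cases q <;> exact absurd hqp (by decide)))

/-! ### §5. The inconsistency -/

/-- ONE primitive λ-eigenfunction for the `a_ℓ` of ANY curve of conductor `384` refutes the typed W-law.
[folklore] -/
theorem lambda128BrandtWLawAtPrime_false_of_line (W : WeierstrassCurve ℚ) [W.IsElliptic]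
    [W.IsGloballyMinimal] (hN : W.conductorNorm ℤ = 384)
    (hex : ∃ (o : Fin 2) (f : Fin 2 → Fin (3 + 1) → GaussianInt),
      IsPrimitiveGauss 3 f ∧ IsLamHeckeEigen o 3 f fun n => W.LFunction n) :
    ¬ Lambda128BrandtWLawAtPrime := fun h153 => by
  obtain ⟨o, f, hprim, heig⟩ := hex
  exact lambda128BrandtWLawAtPrime_empties_384 h153 W hN o f hprim heig

/-- **Rows E-desc-145 and E-desc-153 are jointly inconsistent as typed**: the new-line row produces a
primitive λ-eigenfunction at 384b1, the W-law row (junk `localRootNumberAt = 0`) forbids one.  Equivalently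
`¬ (Lambda128BrandtNewLineAtPrime ∧ Lambda128BrandtWLawAtPrime)`. [folklore] -/
theorem lambda128BrandtWLawAtPrime_false_of_newLine (h145 : Lambda128BrandtNewLineAtPrime) :
    ¬ Lambda128BrandtWLawAtPrime :=
  haveI := isElliptic_384b1
  haveI := isGloballyMinimal_384b1
  lambda128BrandtWLawAtPrime_false_of_line ((⟨0, -1, 0, 2, -2⟩ : WeierstrassCurve ℤ).baseChange ℚ) conductorNorm_384b1
    (h145 3 Nat.prime_three (by norm_num) ((⟨0, -1, 0, 2, -2⟩ : WeierstrassCurve ℤ).baseChange ℚ) (by rw [conductorNorm_384b1])).1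

end Summit.BirchSwinnertonDyer.BirchSwinnertonDyer.Theorems.ManinOddAtFour.Negative
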